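import Mathlib
import HarnessLib

/-!
# [CP-I] Lemma 9.4 / [Fu1997] Prop 3.8, step (T3): inverting unit-monomial relations by the
adjugate — the relations (†) `x_j^D · δ'_j ∈ K`, kernel-checked for any number of parameters

Sources.  D. Fu, *Local weak simultaneous resolution for high rational ranks*, J. Algebra 194
(1997) 614–630 [cite: Fu1997, Prop 3.8 (p. 628 l. 13–19)]; V. Cossart, O. Piltant, *Resolution
of singularities of threefolds in positive characteristic I*, J. Algebra 320 (2008) 1051–1082
[cite: CossartPiltant2008, Lemma 9.4 (HAL p. 30 l. 14–16) and Prop 8.1 (HAL p. 22)].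

Context.  In the transport (T0)–(T5) of [Fu1997, Thm 3.6] to an arbitrary ground field recorded
in `CossartPiltant200819/PrimaryContraction2008.lean` (module docstring and the named hypothesis
`CP2008.PrimaryTransformRankOne`), step (T2) ends with elements `w₁, …, w_r ∈ K` of the SMALL
field written in a local uniformization `S` of the valuation on the BIG field `L` as
`wᵢ = δᵢ · x₁^{a_{i1}} ⋯ x_r^{a_{ir}}` with `δᵢ` units of `S` and `x₁, …, x_r` part of a regular
system of parameters, and with `det(a_{ij}) ≠ 0` because the values `ν(wᵢ) = Σⱼ a_{ij} ν(xⱼ)` are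
rationally independent.  Step (T3) is Fu's sentence (p. 628; file `p0015.txt` L28–33 of the held text
[corpus:paper:doi-10-1006-jabr-1996-7014], verbatim): "Let
`A = (a_{ij})` be the `r × r` matrix with entries `a_{ij}`, and let `D = |det(A)|`. Since the
`ν(wᵢ)` are rationally independent, `D ≠ 0`, and since the taking of quotients and powers of the
`wᵢ` corresponds to ℤ-row operations on `A`, it follows that there are units `dᵢ ∈ S` such that
`x₁^D d₁, …, x_r^D d_r ∈ K ∩ N = N ⊂ Q`."  Fu argues by ℤ-ROW OPERATIONS on `A`; this module realises
them by ONE explicit choice, multiplication through by the adjugate of `A` (attribution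
precision, REFEREE R-cp2-g14-1: the adjugate is this module's device, not Fu's wording; both
give the same `D = |det A|` and units).  The result is, for every `j`, a unit `δ'ⱼ` of `S` with
`xⱼ^D · δ'ⱼ ∈ K`, `D = |det A| ≥ 1` (uniform in `j` as in Fu; stated per `j` below, the weaker
form that `hdag` consumes) — the relations (†) that feed
`CP2008.contractedCentrePrimary_of_dagger` (whose hypothesis `hdag` is literally the conclusion
of `dagger_of_monomial_relations` below, for `ι = Fin 3`).  This module PROVES (T3) as pure
algebra, for an arbitrary finite index type `ι` (any rational rank / dimension), so that of the
transported proof only (T0)–(T2) (the geometric inputs: Cor 4.6, Prop 8.1, `S` a UFD) and (T5)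
(the `r = 2` descent) remain prose.  No dimension hypothesis, no hypothesis on the fields.

Contents (all PROVED, no definitions):
* `zpow_finset_sum₀` — `a ≠ 0 ⇒ a^{Σ fᵢ} = ∏ a^{fᵢ}` for integer exponents [folklore];
* `prod_zpow_adjugate_eq` — the Laurent-monomial identity
  `∏ᵢ wᵢ^{adj(A)ⱼᵢ} = (∏ᵢ δᵢ^{adj(A)ⱼᵢ}) · xⱼ^{det A}` in any field, from
  `Matrix.adjugate_mul` (this module's rendering of Fu's "ℤ-row operations on `A`")
  [cite: Fu1997, Prop 3.8 (p. 628)];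
* `zpow_mem_of_inv_mem` — a subalgebra containing `a` and `a⁻¹` contains every `a^z` [folklore];
* `dagger_of_monomial_relations` — (†): `∀ j, ∃ D > 0, ∃ u ∈ S` a unit of `S` with
  `xⱼ^D · u ∈ range (K → L)` [cite: Fu1997, Prop 3.8 (p. 628)], [cite: CossartPiltant2008,
  Lemma 9.4 (HAL p. 30)].
-/

namespace Literature.AlgebraicGeometry.CossartPiltant200819.MonomialInversion

open Matrix Finset

section Identity

variable {L : Type*} [Field L]

/-- `a ≠ 0 ⇒ a^{Σᵢ fᵢ} = ∏ᵢ a^{fᵢ}` for integer exponents (the `a ≠ 0` is needed: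
`0^{1 + (−1)} = 1 ≠ 0 = 0¹ · 0⁻¹`).  [folklore] -/
theorem zpow_finset_sum₀ {κ : Type*} {a : L} (ha : a ≠ 0) (s : Finset κ) (f : κ → ℤ) :
    a ^ (∑ i ∈ s, f i) = ∏ i ∈ s, a ^ f i := by
  classical
  induction s using Finset.induction_on with
  | empty => simp
  | insert i s hi ih => rw [Finset.sum_insert hi, Finset.prod_insert hi, zpow_add₀ ha, ih]

variable {ι : Type*} [Fintype ι] [DecidableEq ι]

/-- Fu's "ℤ-row operations on `A`" [Fu1997, Prop 3.8, p. 628], realised here by the adjugate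
(one explicit choice of the row operations): if `wᵢ = δᵢ ∏ₗ xₗ^{A i l}` with all
`xₗ ≠ 0`, then for every `j`
`∏ᵢ wᵢ^{adj(A) j i} = (∏ᵢ δᵢ^{adj(A) j i}) · xⱼ^{det A}`
(integer exponents; `adj(A) · A = det A · 1`).  Any finite index type `ι`.
[cite: Fu1997, Prop 3.8 (p. 628)] -/
theorem prod_zpow_adjugate_eq (x δ w : ι → L) (hx : ∀ l, x l ≠ 0) (A : Matrix ι ι ℕ)
    (hrel : ∀ i, w i = δ i * ∏ l, x l ^ A i l) (j : ι) :
    ∏ i, w i ^ (A.map (Nat.cast : ℕ → ℤ)).adjugate j i =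
      (∏ i, δ i ^ (A.map (Nat.cast : ℕ → ℤ)).adjugate j i) *
        x j ^ (A.map (Nat.cast : ℕ → ℤ)).det := by
  set Az : Matrix ι ι ℤ := A.map (Nat.cast : ℕ → ℤ) with hAz
  set B : Matrix ι ι ℤ := Az.adjugate with hB
  have hBA : B * Az = Az.det • (1 : Matrix ι ι ℤ) := Matrix.adjugate_mul Az
  have hentry : ∀ l, (∑ i, (A i l : ℤ) * B j i) = (B * Az) j l := by
    intro l
    rw [Matrix.mul_apply]
    refine Finset.sum_congr rfl fun i _ => ?_
    rw [hAz, Matrix.map_apply, mul_comm]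
  calc ∏ i, w i ^ B j i = ∏ i, (δ i ^ B j i * ∏ l, x l ^ ((A i l : ℤ) * B j i)) := by
        refine Finset.prod_congr rfl fun i _ => ?_
        rw [hrel i, mul_zpow, ← Finset.prod_zpow]
        congr 1
        refine Finset.prod_congr rfl fun l _ => ?_
        rw [← zpow_natCast, ← _root_.zpow_mul]
    _ = (∏ i, δ i ^ B j i) * ∏ i, ∏ l, x l ^ ((A i l : ℤ) * B j i) := Finset.prod_mul_distrib
    _ = (∏ i, δ i ^ B j i) * ∏ l, x l ^ (∑ i, (A i l : ℤ) * B j i) := by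
        rw [Finset.prod_comm]
        congr 1
        exact Finset.prod_congr rfl fun l _ => (zpow_finset_sum₀ (hx l) _ _).symm
    _ = (∏ i, δ i ^ B j i) * x j ^ Az.det := by
        congr 1
        simp_rw [hentry, hBA, Matrix.smul_apply, Matrix.one_apply, smul_eq_mul, mul_ite, mul_one,
          mul_zero]
        rw [Finset.prod_eq_single j (fun l _ hl => by rw [if_neg (Ne.symm hl), zpow_zero])
          (fun h => absurd (Finset.mem_univ j) h), if_pos rfl]

end Identity

section Dagger

variable {k K L : Type*} [Field k] [Field K] [Field L] [Algebra K L] [Algebra k L]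

/-- A subalgebra containing `a` and `a⁻¹` contains all integer powers of `a`.  [folklore] -/
theorem zpow_mem_of_inv_mem {S : Subalgebra k L} {a : L} (ha : a ∈ S) (ha' : a⁻¹ ∈ S) :
    ∀ z : ℤ, a ^ z ∈ S
  | (n : ℕ) => by rw [zpow_natCast]; exact S.pow_mem ha n
  | Int.negSucc n => by rw [zpow_negSucc, ← inv_pow]; exact S.pow_mem ha' _

variable {ι : Type*} [Fintype ι] [DecidableEq ι]

/-- **(T3), the relations (†)** [Fu1997, Prop 3.8, p. 628 l. 13–19; used verbatim in the transport
of Fu's Thm 3.6 into [CP-I] Lemma 9.4]: let `S` be a `k`-subalgebra of the big field `L`,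
`x : ι → L` nonzero elements (the parameters `x₁, …, x_r`), `δᵢ ∈ S` units of `S`, `wᵢ ∈ K`
elements of the small field with `wᵢ = δᵢ ∏ₗ xₗ^{A i l}` in `L`, and `det A ≠ 0`.  Then for every
`j` there are `D ≥ 1` and a unit `u` of `S` with `xⱼ^D · u ∈ K` — precisely the hypothesis `hdag`
of `CP2008.contractedCentrePrimary_of_dagger` (there `ι = Fin 3`).  Here `D = |det A|` and
`u = (∏ᵢ δᵢ^{adj(A) j i})^{±1}`.  Any finite `ι`: no rank or dimension hypothesis.
[cite: Fu1997, Prop 3.8 (p. 628)] [cite: CossartPiltant2008, Lemma 9.4 (HAL p. 30 l. 14–16)] -/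
theorem dagger_of_monomial_relations (S : Subalgebra k L) (x : ι → L) (hx : ∀ l, x l ≠ 0)
    (δ : ι → L) (hδS : ∀ i, δ i ∈ S) (hδu : ∀ i, ∃ δ' ∈ S, δ i * δ' = 1)
    (w : ι → K) (A : Matrix ι ι ℕ)
    (hrel : ∀ i, algebraMap K L (w i) = δ i * ∏ l, x l ^ A i l)
    (hdet : (A.map (Nat.cast : ℕ → ℤ)).det ≠ 0) (j : ι) :
    ∃ D : ℕ, 0 < D ∧ ∃ u ∈ S, (∃ u' ∈ S, u * u' = 1) ∧
      x j ^ D * u ∈ Set.range (algebraMap K L) := by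
  set Az : Matrix ι ι ℤ := A.map (Nat.cast : ℕ → ℤ) with hAz
  set B : Matrix ι ι ℤ := Az.adjugate with hB
  set d : ℤ := Az.det with hd
  set u : L := ∏ i, δ i ^ B j i with hu
  have hδ0 : ∀ i, δ i ≠ 0 := fun i h => by
    obtain ⟨δ', -, h1⟩ := hδu i
    rw [h, zero_mul] at h1
    exact zero_ne_one h1
  have hδinv : ∀ i, (δ i)⁻¹ ∈ S := fun i => by
    obtain ⟨δ', hδ', h1⟩ := hδu i
    rw [inv_eq_of_mul_eq_one_right h1]
    exact hδ'
  have huS : u ∈ S := prod_mem fun i _ => zpow_mem_of_inv_mem (hδS i) (hδinv i) _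
  have hu'S : u⁻¹ ∈ S := by
    rw [hu, ← Finset.prod_inv_distrib]
    exact prod_mem fun i _ => by
      rw [← _root_.zpow_neg]; exact zpow_mem_of_inv_mem (hδS i) (hδinv i) _
  have hu0 : u ≠ 0 := Finset.prod_ne_zero_iff.mpr fun i _ => zpow_ne_zero _ (hδ0 i)
  -- Fu's identity, pushed through `K → L`
  have hid : algebraMap K L (∏ i, w i ^ B j i) = u * x j ^ d := by
    rw [map_prod]
    simp_rw [map_zpow₀]
    exact prod_zpow_adjugate_eq x δ (fun i => algebraMap K L (w i)) hx A hrel j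
  rcases lt_or_gt_of_ne hdet with hneg | hpos
  · -- `det A < 0`: invert the identity
    refine ⟨(-d).toNat, by omega, u⁻¹, hu'S, ⟨u, huS, inv_mul_cancel₀ hu0⟩,
      (∏ i, w i ^ B j i)⁻¹, ?_⟩
    rw [map_inv₀, hid]
    have hD : (((-d).toNat : ℕ) : ℤ) = -d := Int.toNat_of_nonneg (by omega)
    rw [← zpow_natCast, hD, mul_inv, _root_.zpow_neg]
    exact mul_comm _ _
  · -- `det A > 0`
    refine ⟨d.toNat, by omega, u, huS, ⟨u⁻¹, hu'S, mul_inv_cancel₀ hu0⟩, ∏ i, w i ^ B j i, ?_⟩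
    rw [hid]
    have hD : ((d.toNat : ℕ) : ℤ) = d := Int.toNat_of_nonneg hpos.le
    rw [← zpow_natCast, hD]
    exact mul_comm _ _

/-- Sanity instance (`r = 1`): one relation `w = δ x^a` with `a ≥ 1` gives (†) with `D = a`,
`u = δ`'s power — here checked through the general statement with `ι = Fin 1`.  [folklore] -/
example (S : Subalgebra k L) (x δ : L) (hx : x ≠ 0) (hδS : δ ∈ S) (hδu : ∃ δ' ∈ S, δ * δ' = 1)
    (w : K) (a : ℕ) (ha : 0 < a) (hrel : algebraMap K L w = δ * x ^ a) :
    ∃ D : ℕ, 0 < D ∧ ∃ u ∈ S, (∃ u' ∈ S, u * u' = 1) ∧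
      x ^ D * u ∈ Set.range (algebraMap K L) := by
  have h := dagger_of_monomial_relations S (fun _ : Fin 1 => x) (fun _ => hx) (fun _ => δ)
    (fun _ => hδS) (fun _ => hδu) (fun _ => w) (Matrix.of fun _ _ => a)
    (fun _ => by simpa using hrel) (by simpa using ha.ne') 0
  simpa using h

end Dagger

end Literature.AlgebraicGeometry.CossartPiltant200819.MonomialInversion
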